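import Summits.CriticalPhenomena.SAWScalingLimit.Theorems.SAWDevelopingMapHexTightReversalDefs
import Literature.Probability.RandomPlanarGeometry.HexMidEdgeSAWDoors

/-!
# The reversal recursion (stub `stub_diveRecursion` of the line `reversal-virgin-disc`, crux `HexTight`)

Crux `stmt-CriticalPhenomena-5423`
(`Summit.CriticalPhenomena.SAWScalingLimit.Theses.SAWDevelopingMap.HexTight`, eventual tightness of
the critical hexagonal-lattice SAW laws), line `reversal-virgin-disc`, registered stub
`stub_diveRecursion` (`= DiveRecursion` of the lead's skeleton), over the objects of
`…Theorems.SAWDevelopingMapHexTightReversalDefs` (`IsHArc`, `arcMass`, `diveMass`, `Straddles`,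
`IsVirgin`).

**Statement.** In a virgin configuration `(H, Λ)` at radius `N` about `z₀` with doors `w, w'`, for
radii `r₂ ≤ r₁ ≤ N`: if every virgin sub-configuration `(H, Λ' ⊆ Λ)` at radius `r₁` with doors
`u, u'` has dive-to-`r₂` ratio `diveMass / arcMass ≤ q`, then
`diveMass(r₂) ≤ q · diveMass(r₁)`.

**Proof (exact combinatorics, no lattice geometry).** Every `H`-arc diving to `r₂` dives to `r₁`.
Cut an `H`-arc `γ` diving to `r₁` at its FIRST vertex `c₁` and its LAST vertex `c_L` in the closed
`r₁`-disc: `γ.verts = β ++ α ++ β'` (`exists_split_first_last`; `β`, `β'` strictly outside the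
disc). GROUP the arcs by `(β, c₁, c_L, β')`, computed by `takeWhile`/`dropWhile` from both ends
(`split_first_last_eq`, `split_first_last_iff`), and let `p` be the vertex before `α` (or the outer
vertex `u` of `w`), `p'` the vertex after it (or `u'`). On a group, `γ ↦ α` is a bijection onto
the `H`-arcs of the reduced domain `Λ' = Λ ∖ β ∖ β'` between the doors `{p, c₁}`, `{p', c_L}`
(`HexMidEdgeSAW.exists_cut` / `HexMidEdgeSAW.exists_glue` of
`Literature/…/HexMidEdgeSAWDoors.lean`), shifting the length by `|β| + |β'|` and preserving
"dives to `r₂`" (`diveRecursion_fiber_sum_eq`); the reduced configuration is virgin at `r₁`,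
`Λ' ⊆ Λ`, and the two new mid-edges are doors at radius `r₁`, so the hypothesis bounds the
group's dive-to-`r₂` mass by `q` times its mass (`diveRecursion_fiber_bound`). Summing over the
groups (`Finset.sum_fiberwise_of_maps_to`) gives the claim (`stub_diveRecursion`).

Dependencies (landed for this stub, all [folklore]): `Literature/…/SAWEdgeListSurgery.lean`
(consecutive pairs of concatenations, splicing, first/last-visit decomposition of vertex lists)
and `Literature/…/HexMidEdgeSAWDoors.lean` (doors; `HexMidEdgeSAW.exists_cut`, `.exists_glue`,
`.door_ne_door`, `.rel_door_head`, …). This file: the two fiber lemmas and the registered stub,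
sorry-free, axioms `propext`, `Classical.choice`, `Quot.sound`.
-/

noncomputable section

namespace Summit.CriticalPhenomena.SAWScalingLimit.Theorems.HexTight.Reversal

open scoped BigOperators Classical
open Literature.Probability.LatticeModels Literature.Probability.RandomPlanarGeometry
  Literature.Probability.RandomPlanarGeometry.SAW

/-! ### One group of the reversal recursion -/

/-- **The connector bijection, as an identity of sums.** For the group of `H`-arcs `β ++ α ++ β'`
(`α` from `c₁` to `c_L`) between the doors `{u, c}`, `{u', c'}` of `Λ`, and any weight `F` of the
vertex list, the sum of `F` over the group equals the sum of `F(β ++ · ++ β')` over the `H`-arcs of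
the reduced domain `Λ ∖ β ∖ β'` between the doors `{p, c₁}`, `{p', c_L}` (cut/glue bijection). -/
theorem diveRecursion_fiber_sum_eq {H : SimpleGraph HexVertex} {Λ : Finset HexVertex}
    {u c u' c' : HexVertex} (hu : u ∉ Λ) (hu' : u' ∉ Λ) (γ₀ : HexMidEdgeSAW Λ s(u, c) s(u', c'))
    (h₀ : IsHArc H γ₀)
    {β α₀ β' I T : List HexVertex} {p p' c₁ c₂ : HexVertex}
    (hdec : γ₀.verts = β ++ α₀ ++ β') (hh₀ : α₀.head? = some c₁) (hl₀ : α₀.getLast? = some c₂)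
    (hp : u :: β = I ++ [p]) (hp' : β' ++ [u'] = p' :: T) (hpc : hexGraph.Adj p c₁)
    (A : Finset (HexMidEdgeSAW Λ s(u, c) s(u', c')))
    (hA : ∀ γ, γ ∈ A ↔ IsHArc H γ ∧
      ∃ α, γ.verts = β ++ α ++ β' ∧ α.head? = some c₁ ∧ α.getLast? = some c₂)
    (F : List HexVertex → ℝ) :
    ∑ γ ∈ A, F γ.verts =
      ∑ δ : HexMidEdgeSAW ((Λ \ β.toFinset) \ β'.toFinset) s(p, c₁) s(p', c₂),
        if IsHArc H δ then F (β ++ δ.verts ++ β') else 0 := by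
  have hpΛ' := notMem_sdiff_of_cons_eq_concat β' hu hp
  have hp'Λ' := notMem_sdiff_of_concat_eq_cons β hu' hp'
  have hm := γ₀.door_ne_door rfl rfl hu hu' hdec hh₀ hl₀ hp hp'
  set B : Finset (HexMidEdgeSAW ((Λ \ β.toFinset) \ β'.toFinset) s(p, c₁) s(p', c₂)) :=
    Finset.univ.filter fun δ => IsHArc H δ with hB
  have hset : A.image HexMidEdgeSAW.verts = B.image fun δ => β ++ δ.verts ++ β' := by
    ext L
    simp only [Finset.mem_image, hB, Finset.mem_filter, Finset.mem_univ, true_and, hA]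
    constructor
    · rintro ⟨γ, ⟨hγ, α, hdecγ, hh, hl⟩, rfl⟩
      obtain ⟨δ, hδ, hδv⟩ := γ.exists_cut rfl rfl hu hu' hγ hdecγ hh hl hp hp' hpc
      exact ⟨δ, hδ, by rw [hδv, hdecγ]⟩
    · rintro ⟨δ, hδ, rfl⟩
      obtain ⟨γ, hγ, hγv⟩ := γ₀.exists_glue rfl rfl hu hu' h₀ hdec hh₀ hl₀ hp hp' δ hδ
      obtain ⟨hh, hl⟩ := HexMidEdgeSAW.head?_getLast?_of_doors hpΛ' hp'Λ' hm δ
      exact ⟨γ, ⟨hγ, δ.verts, hγv, hh, hl⟩, hγv⟩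
  calc ∑ γ ∈ A, F γ.verts = ∑ L ∈ A.image HexMidEdgeSAW.verts, F L :=
        (Finset.sum_image fun x _ y _ h => HexMidEdgeSAW.ext h).symm
    _ = ∑ L ∈ B.image (fun δ => β ++ δ.verts ++ β'), F L := by rw [hset]
    _ = ∑ δ ∈ B, F (β ++ δ.verts ++ β') :=
        Finset.sum_image fun x _ y _ h =>
          HexMidEdgeSAW.ext (List.append_cancel_left (List.append_cancel_right h))
    _ = _ := by rw [hB, Finset.sum_filter]

/-- **One group of the reversal recursion.** In a virgin configuration at radius `N ≥ r₁` with
doors `{u, c}`, `{u', c'}`, fix a model `H`-arc `γ₀ = β ++ α₀ ++ β'` cut at its first and last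
vertices `c₁`, `c_L` in the closed `r₁`-disc (`β`, `β'` strictly outside it). Over the group `A` of
`H`-arcs `β ++ α ++ β'` with `α` from `c₁` to `c_L`, the dive-to-`r₂` mass is at most `q` times the
mass, `q` being the dive ratio bound of the (virgin at `r₁`) reduced configuration. -/
theorem diveRecursion_fiber_bound {H : SimpleGraph HexVertex} {Λ : Finset HexVertex} {z₀ : ℂ}
    {N r₁ r₂ q : ℝ} {u c u' c' : HexVertex} (h₂₁ : r₂ ≤ r₁) (h₁N : r₁ ≤ N)
    (hV : IsVirgin H Λ z₀ N) (huc : hexGraph.Adj u c) (hu : u ∉ Λ)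
    (hNu : N < dist (hexCenter u) z₀) (huc' : hexGraph.Adj u' c') (hu' : u' ∉ Λ)
    (hNu' : N < dist (hexCenter u') z₀)
    (hrec : ∀ (Λ' : Finset HexVertex) (m m' : Sym2 HexVertex), Λ' ⊆ Λ →
      IsVirgin H Λ' z₀ r₁ → Straddles Λ' z₀ r₁ m → Straddles Λ' z₀ r₁ m' →
      diveMass H Λ' m m' z₀ r₂ ≤ q * arcMass H Λ' m m')
    (γ₀ : HexMidEdgeSAW Λ s(u, c) s(u', c')) (h₀ : IsHArc H γ₀)
    {β α₀ β' : List HexVertex} {c₁ c₂ : HexVertex}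
    (hdec : γ₀.verts = β ++ α₀ ++ β') (hh₀ : α₀.head? = some c₁) (hl₀ : α₀.getLast? = some c₂)
    (hc₁ : dist (hexCenter c₁) z₀ ≤ r₁) (hc₂ : dist (hexCenter c₂) z₀ ≤ r₁)
    (hβ : ∀ v ∈ β, r₁ < dist (hexCenter v) z₀) (hβ' : ∀ v ∈ β', r₁ < dist (hexCenter v) z₀)
    (A : Finset (HexMidEdgeSAW Λ s(u, c) s(u', c')))
    (hA : ∀ γ, γ ∈ A ↔ IsHArc H γ ∧
      ∃ α, γ.verts = β ++ α ++ β' ∧ α.head? = some c₁ ∧ α.getLast? = some c₂) :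
    ∑ γ ∈ A, (if ∃ v ∈ γ.verts, dist (hexCenter v) z₀ ≤ r₂ then
        hexCriticalFugacity ^ γ.length else 0) ≤
      q * ∑ γ ∈ A, hexCriticalFugacity ^ γ.length := by
  obtain ⟨I, p, hp⟩ : ∃ I p, u :: β = I ++ [p] :=
    ⟨_, _, (List.dropLast_concat_getLast (List.cons_ne_nil u β)).symm⟩
  obtain ⟨T, p', hp'⟩ : ∃ T p', β' ++ [u'] = p' :: T :=
    ⟨_, _, (List.cons_head_tail (by simp)).symm⟩
  set Λ' := (Λ \ β.toFinset) \ β'.toFinset with hΛ'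
  have hpΛ' : p ∉ Λ' := notMem_sdiff_of_cons_eq_concat β' hu hp
  have hp'Λ' : p' ∉ Λ' := notMem_sdiff_of_concat_eq_cons β hu' hp'
  have hc₁Λ' : c₁ ∈ Λ' := γ₀.mem_sdiff_of_mem_mid hdec (List.mem_of_head? hh₀)
  have hc₂Λ' : c₂ ∈ Λ' := γ₀.mem_sdiff_of_mem_mid hdec (List.mem_of_getLast? hl₀)
  have hpc : hexGraph.Adj p c₁ := γ₀.rel_door_head γ₀.isChain rfl hu huc hdec hh₀ hp
  have hp'c : hexGraph.Adj p' c₂ :=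
    (γ₀.rel_getLast_door γ₀.isChain rfl hu' huc'.symm hdec hl₀ hp').symm
  have hpout : r₁ < dist (hexCenter p) z₀ := by
    have h : p ∈ u :: β := by rw [hp]; simp
    rcases List.mem_cons.1 h with h | h
    · rw [h]; exact lt_of_le_of_lt h₁N hNu
    · exact hβ p h
  have hp'out : r₁ < dist (hexCenter p') z₀ := by
    have h : p' ∈ β' ++ [u'] := by rw [hp']; simp
    rcases List.mem_append.1 h with h | h
    · exact hβ' p' h
    · rw [List.mem_singleton.1 h]; exact lt_of_le_of_lt h₁N hNu'
  have hsub : Λ' ⊆ Λ := Finset.sdiff_subset.trans Finset.sdiff_subset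
  have hV' : IsVirgin H Λ' z₀ r₁ := by
    refine ⟨fun v hv => ?_, fun v v' hv hv' hadj => hV.adj v v' (by linarith) (by linarith) hadj⟩
    simp only [hΛ', Finset.mem_sdiff, List.mem_toFinset]
    exact ⟨⟨hV.mem v (lt_of_lt_of_le hv h₁N), fun h => absurd (hβ v h) (not_lt.2 hv.le)⟩,
      fun h => absurd (hβ' v h) (not_lt.2 hv.le)⟩
  have hSm : Straddles Λ' z₀ r₁ s(p, c₁) := ⟨p, c₁, rfl, hpc, hpΛ', hc₁Λ', hc₁, hpout⟩
  have hSm' : Straddles Λ' z₀ r₁ s(p', c₂) := ⟨p', c₂, rfl, hp'c, hp'Λ', hc₂Λ', hc₂, hp'out⟩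
  have hq' := hrec Λ' _ _ hsub hV' hSm hSm'
  have hk : 0 ≤ hexCriticalFugacity ^ (β.length + β'.length) :=
    pow_nonneg hexCriticalFugacity_pos_lt_one.1.le _
  have hdiv : ∀ α : List HexVertex, (∃ v ∈ β ++ α ++ β', dist (hexCenter v) z₀ ≤ r₂) ↔
      ∃ v ∈ α, dist (hexCenter v) z₀ ≤ r₂ := by
    intro α
    constructor
    · rintro ⟨v, hv, hd⟩
      rcases List.mem_append.1 hv with hv | hv
      · rcases List.mem_append.1 hv with hv | hv
        · exact absurd (hβ v hv) (not_lt.2 (hd.trans h₂₁))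
        · exact ⟨v, hv, hd⟩
      · exact absurd (hβ' v hv) (not_lt.2 (hd.trans h₂₁))
    · rintro ⟨v, hv, hd⟩
      exact ⟨v, List.mem_append_left _ (List.mem_append_right _ hv), hd⟩
  have hlen : ∀ α : List HexVertex, hexCriticalFugacity ^ (β ++ α ++ β').length =
      hexCriticalFugacity ^ (β.length + β'.length) * hexCriticalFugacity ^ α.length := by
    intro α
    rw [List.length_append, List.length_append, ← pow_add]
    congr 1; omega
  have e₂ : ∑ γ ∈ A, (if ∃ v ∈ γ.verts, dist (hexCenter v) z₀ ≤ r₂ then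
      hexCriticalFugacity ^ γ.length else 0) =
      hexCriticalFugacity ^ (β.length + β'.length) * diveMass H Λ' s(p, c₁) s(p', c₂) z₀ r₂ := by
    rw [diveMass, Finset.mul_sum]
    refine (diveRecursion_fiber_sum_eq hu hu' γ₀ h₀ hdec hh₀ hl₀ hp hp' hpc A hA (fun L =>
      if ∃ v ∈ L, dist (hexCenter v) z₀ ≤ r₂ then hexCriticalFugacity ^ L.length else 0)).trans ?_
    refine Finset.sum_congr rfl fun δ _ => ?_
    by_cases hH : IsHArc H δ
    · by_cases hd : ∃ v ∈ δ.verts, dist (hexCenter v) z₀ ≤ r₂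
      · rw [if_pos hH, if_pos ((hdiv _).2 hd), if_pos ⟨hH, hd⟩, hlen]; rfl
      · rw [if_pos hH, if_neg (fun h => hd ((hdiv _).1 h)), if_neg (fun h => hd h.2), mul_zero]
    · rw [if_neg hH, if_neg (fun h => hH h.1), mul_zero]
  have e₁ : ∑ γ ∈ A, hexCriticalFugacity ^ γ.length =
      hexCriticalFugacity ^ (β.length + β'.length) * arcMass H Λ' s(p, c₁) s(p', c₂) := by
    rw [arcMass, Finset.mul_sum]
    refine (diveRecursion_fiber_sum_eq hu hu' γ₀ h₀ hdec hh₀ hl₀ hp hp' hpc A hA (fun L =>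
      hexCriticalFugacity ^ L.length)).trans ?_
    refine Finset.sum_congr rfl fun δ _ => ?_
    by_cases hH : IsHArc H δ
    · rw [if_pos hH, if_pos hH, hlen]; rfl
    · rw [if_neg hH, if_neg hH, mul_zero]
  rw [e₂, e₁]
  calc hexCriticalFugacity ^ (β.length + β'.length) * diveMass H Λ' s(p, c₁) s(p', c₂) z₀ r₂
      ≤ hexCriticalFugacity ^ (β.length + β'.length) * (q * arcMass H Λ' s(p, c₁) s(p', c₂)) :=
        mul_le_mul_of_nonneg_left hq' hk
    _ = q * (hexCriticalFugacity ^ (β.length + β'.length) * arcMass H Λ' s(p, c₁) s(p', c₂)) := by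
        ring

/-! ### The registered stub -/

/-- **stub 1 — REVERSAL RECURSION** (`= DiveRecursion` of the line `reversal-virgin-disc`). In a
virgin configuration at radius `N` with doors `w, w'`, for radii `r₂ ≤ r₁ ≤ N`: if every virgin
sub-configuration `(H, Λ' ⊆ Λ)` at radius `r₁` with doors `u, u'` has dive-to-`r₂` ratio `≤ q`,
then `diveMass(r₂) ≤ q · diveMass(r₁)`. Proof: group the `H`-arcs diving to `r₁` by the prefix
before the first vertex in the closed `r₁`-disc, that vertex, the last vertex in the disc and the
suffix after it (`exists_split_first_last`, `split_first_last_eq`); on each group the connector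
map is a weight-shifting bijection onto the `H`-arcs of the reduced domain between the two doors
(`diveRecursion_fiber_sum_eq`), whose configuration is virgin at `r₁` (`diveRecursion_fiber_bound`); sum over the groups. -/
theorem stub_diveRecursion :
    ∀ (H : SimpleGraph HexVertex) (Λ : Finset HexVertex) (z₀ : ℂ) (N r₁ r₂ q : ℝ)
      (w w' : Sym2 HexVertex),
      0 ≤ q → r₂ ≤ r₁ → r₁ ≤ N →
      IsVirgin H Λ z₀ N → Straddles Λ z₀ N w → Straddles Λ z₀ N w' →
      (∀ (Λ' : Finset HexVertex) (u u' : Sym2 HexVertex), Λ' ⊆ Λ →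
          IsVirgin H Λ' z₀ r₁ → Straddles Λ' z₀ r₁ u → Straddles Λ' z₀ r₁ u' →
          diveMass H Λ' u u' z₀ r₂ ≤ q * arcMass H Λ' u u') →
      diveMass H Λ w w' z₀ r₂ ≤ q * diveMass H Λ w w' z₀ r₁ := by
  intro H Λ z₀ N r₁ r₂ q w w' _ h₂₁ h₁N hV hw hw' hrec
  obtain ⟨u, c, rfl, huc, hu, -, -, hNu⟩ := hw
  obtain ⟨u', c', rfl, huc', hu', -, -, hNu'⟩ := hw'
  -- the outside predicate and the group index
  set out : HexVertex → Bool := fun v => decide (r₁ < dist (hexCenter v) z₀) with hout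
  have hout_false : ∀ v, out v = false ↔ dist (hexCenter v) z₀ ≤ r₁ := fun v => by
    simp [hout, not_lt]
  have hout_true : ∀ v, out v = true ↔ r₁ < dist (hexCenter v) z₀ := fun v => by simp [hout]
  set idx : HexMidEdgeSAW Λ s(u, c) s(u', c') →
      List HexVertex × Option HexVertex × Option HexVertex × List HexVertex :=
    fun γ => (γ.verts.takeWhile out, (γ.verts.dropWhile out).head?,
      (γ.verts.reverse.dropWhile out).head?, (γ.verts.reverse.takeWhile out).reverse) with hidx
  set S : Finset (HexMidEdgeSAW Λ s(u, c) s(u', c')) :=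
    Finset.univ.filter (fun γ => IsHArc H γ ∧ ∃ v ∈ γ.verts, dist (hexCenter v) z₀ ≤ r₁) with hS
  have hmemS : ∀ γ, γ ∈ S ↔ IsHArc H γ ∧ ∃ v ∈ γ.verts, dist (hexCenter v) z₀ ≤ r₁ := fun γ => by
    rw [hS, Finset.mem_filter]; simp only [Finset.mem_univ, true_and]
  have hD₂ : diveMass H Λ s(u, c) s(u', c') z₀ r₂ = ∑ γ ∈ S,
      if ∃ v ∈ γ.verts, dist (hexCenter v) z₀ ≤ r₂ then hexCriticalFugacity ^ γ.length else 0 := by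
    unfold diveMass
    rw [hS, Finset.sum_filter]
    refine Finset.sum_congr rfl fun γ _ => ?_
    by_cases hA : IsHArc H γ
    · by_cases h₂ : ∃ v ∈ γ.verts, dist (hexCenter v) z₀ ≤ r₂
      · have h₁ : ∃ v ∈ γ.verts, dist (hexCenter v) z₀ ≤ r₁ := by
          obtain ⟨v, hv, hd⟩ := h₂; exact ⟨v, hv, hd.trans h₂₁⟩
        rw [if_pos ⟨hA, h₂⟩, if_pos ⟨hA, h₁⟩, if_pos h₂]
      · rw [if_neg fun h => h₂ h.2]
        by_cases h₁ : ∃ v ∈ γ.verts, dist (hexCenter v) z₀ ≤ r₁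
        · rw [if_pos ⟨hA, h₁⟩, if_neg h₂]
        · rw [if_neg fun h => h₁ h.2]
    · rw [if_neg fun h => hA h.1, if_neg fun h => hA h.1]
  have hD₁ : diveMass H Λ s(u, c) s(u', c') z₀ r₁ = ∑ γ ∈ S, hexCriticalFugacity ^ γ.length := by
    unfold diveMass
    rewrite [hS, Finset.sum_filter]
    exact Finset.sum_congr rfl fun γ _ => by congr 1
  rw [hD₂, hD₁]
  have hmaps : ∀ γ ∈ S, idx γ ∈ S.image idx := fun γ hγ => Finset.mem_image_of_mem idx hγ
  rw [← Finset.sum_fiberwise_of_maps_to hmaps, ← Finset.sum_fiberwise_of_maps_to hmaps,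
    Finset.mul_sum]
  refine Finset.sum_le_sum fun g hg => ?_
  obtain ⟨γ₀, hγ₀, rfl⟩ := Finset.mem_image.1 hg
  obtain ⟨h₀, v₀, hv₀, hv₀r⟩ := (hmemS γ₀).1 hγ₀
  obtain ⟨β, α₀, β', c₁, c₂, hdec, hh₀, hl₀, hc₁, hc₂, hβ, hβ'⟩ :=
    exists_split_first_last out (L := γ₀.verts) ⟨v₀, hv₀, (hout_false v₀).2 hv₀r⟩
  obtain ⟨f1, f2, f3, f4⟩ := split_first_last_eq out hh₀ hl₀ hc₁ hc₂ hβ hβ'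
  have hidx₀ : idx γ₀ = (β, some c₁, some c₂, β') := by
    simp only [hidx, hdec, f1, f2, f3, f4]
  refine diveRecursion_fiber_bound h₂₁ h₁N hV huc hu hNu huc' hu' hNu' hrec γ₀ h₀ hdec hh₀ hl₀
    ((hout_false _).1 hc₁) ((hout_false _).1 hc₂) (fun v hv => (hout_true v).1 (hβ v hv))
    (fun v hv => (hout_true v).1 (hβ' v hv)) _ fun γ => ?_
  rw [Finset.mem_filter, hmemS, hidx₀, and_assoc]
  refine and_congr_right fun _ => ?_
  rw [← split_first_last_iff out hc₁ hc₂ hβ hβ']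
  simp only [hidx, Prod.mk.injEq, hout_false]

end Summit.CriticalPhenomena.SAWScalingLimit.Theorems.HexTight.Reversal

end
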